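import Summits.QuantumFields.BalabanUV.Beta.WardLocusStep
import Summits.QuantumFields.BalabanUV.Beta.ChartConjugationRelative
import Summits.QuantumFields.BalabanUV.Beta.KernelWardRelative
import Summits.QuantumFields.BalabanUV.Beta.VertexReflectionContact
import Summits.QuantumFields.BalabanUV.Beta.GAN24.ThirdJetKernel

/-!
# `BalabanUV.Beta.WardLocusCubic` — binder row D1, the WARD binder hW at `j ≥ 1`: THE WARD LAW OF THE VALUE-FUNCTION CUBIC JET
# FOLLOWS FROM THE COMPOSITE BLOCK WARD LAW, for ANY relatively-inverted packed resolvent (repair-agnostic)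

HONEST FRAMING (cell charter, verbatim): «discharging `BetaPertH` makes Bałaban's UV stability UNCONDITIONAL — a real constructive-QFT
result; it is NOT the continuum limit and NOT the Clay problem.»  DERIVED cell leaf (pub-balaban β sub-cell, D1 formalisation swarm seat
`b2b-balaban-beta-d1-formalise-leaf-10`; sequel of `WardLocusStep` p209548 on an1-g25's hW skeleton §2 (W-LS)_{j ≥ 1}); every declaration
is [folklore] kernel algebra over objects ALREADY in the tree, cited BY NAME; no statement of Bałaban's papers is typed, no `[cite:]` tag;
it instantiates NO binder of the β-function wall.  NOT `BetaPertH`, NOT continuum, NOT Clay.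
HONEST DEPENDENCY (cell records, verbatim): «continuum YM on T⁴ ⇐ BetaPertH ∧ nine spine estimates (0/9 proved); BetaPertH ⇐ (D1) ∧ (D4) ∧
CAP+tail; G-an2-4 gates asym, D1 and NE2/3/4.»
ABSOLUTE RULE (cell charter, verbatim): «No internally-minted statement may enter as a cited fact. Every hypothesis is either kernel-proved in
this package or a verbatim quotation of a PUBLISHED theorem with page reference. The manuscript(s) under audit are NOT citable for their own
disputed steps — they are the thing under adjudication; programme-internal (2001/route/tribunal) claims are never citable.»

THE MECHANISM.  The value-function cubic jet of a packed resolvent `K` (blocking `N`) over a fine stencil family `S` is the resolvent sandwich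
of the chain-rule vertex, read on the multiplier block: `e3K K N S κ′ u′ := −mmRead N (K ∘ vertexOfK K N S κ′ u′ ∘ K)` (for `K = KInv (Lc^j)`,
`S = ScNAt ρ (j−1)` this is an2's `SpineRooted.e3NAtOf ρ j`, `e3NAtOf_eq_e3K`).  Its pure-gauge divergence in the (coarse) jet bond is
(i) the sandwich of the divergence of the vertex (linearity: `divV_sandwich`), (ii) which is `conjV 𝕄 (X y)` by an1's
`KernelWardRelative.divV_vertexOfK_eq_conjV` from the ℋ-column Ward law (hH) of `K` and the BLOCK stencil Ward law (hSd) of `S`, (iii) and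
`K ∘ conjV 𝕄 X ∘ K = X ∘ K − K ∘ X` by the sandwiched relative-inverse rules (`ChartConjugationRelative.rule_left_rel/rule_right_rel`,
`comp_conjV_comp_rel`), (iv) whose multiplier-block read against a DIAGONAL generator is the diagonal contact of the value Hessian
`mmRead N K` with the generator's multiplier legs read on the step lattice (`mmRead_conjV_diagK`), (v) which for the block-rotation generator
`ξ • Σ_{v ∈ box} legInd ρ (N•y + v)` (in-block root) is `ξ •` the field-leg indicator of the coarse site `y` (`mmSym_blockGen`).  RESULT
(`divV_e3K_eq_conjV`): **`divV (e3K K N S) y = ξ • conjV (mmRead N K) (diagK (legInd ρ′ y))`** — the (W-LS)_{j} cubic Ward socket of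
`WardLocusStep.hSd_SstepNAt_of_e3Ward` with `c3 = ξ/wVH` once `ffK (bhKStepAt …) = wVH • mmRead (KInv …)` (`ffK_bhKStepAt_succ`), FROM the
level-below block law — the Ward identity PROPAGATES through the renormalisation step for every `K` obeying `RelInv K 𝕄 E` + rules with a
generator commuting with `E`.  All laws are HYPOTHESES (sockets) on `K, S, 𝕄, E, X`; for the RAW one-shot resolvent `KInv` they are NOT
claimed (cf. an3-g29's toy verdict on hR's (L3): the law needs the rooted/dressed resolvent) — the theorem is stated for the resolvent an2's
repair will name.
-/

noncomputable section

open Finset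
open scoped BigOperators
open Literature.MathematicalPhysics.QuantumFieldTheory
open Literature.MathematicalPhysics.QuantumFieldTheory.Balaban1983to89
open Literature.MathematicalPhysics.QuantumFieldTheory.Balaban1983to89.Beta
open B12Sec2to5 (l1 l1_nonneg)
open ExpKernelCalculus (MKer Decays BiLoc VertexFamily comp)
open OneStepResolventKernel (Fib KInv LocStencil vertexOf)
open OneStepKernelFamily (colH vertexOfK vertexOfK_KInv vertexFamily_vertexOfK')
open KernelWard (divV)
open AffineAveraging (box toSite)
open AveragingContours (blk blk_block)
open BalabanStepJetsSucc (mmRead mmRead_inl_inl mmRead_inr_left mmRead_inr_right wVH E2)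
open Summit.QuantumFields.BalabanUV.Beta.TameKernelCalculus
open Summit.QuantumFields.BalabanUV.Beta.ChartConjugation (conjV)
open Summit.QuantumFields.BalabanUV.Beta.ChartConjugationRelative (RelInv rule_left_rel rule_right_rel spr_comp)
open Summit.QuantumFields.BalabanUV.Beta.BorderedHessian (bhKStepAt bhKStepAt_succ_inl_inl diagK diagK_apply conjV_diagK_apply
  comp_diagK_right comp_diagK_left)
open Summit.QuantumFields.BalabanUV.Beta.AveragingWardRootedStencils (legInd legInd_inl legInd_inr)
open Summit.QuantumFields.BalabanUV.Beta.SpineRooted (ScNAt e3NAtOf)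
open Summit.QuantumFields.BalabanUV.Beta.KernelWardRelative (gaugeWt divV_vertexOfK_eq_conjV)
open Summit.QuantumFields.BalabanUV.Beta.WardLocusStencils (ffK ffK_inl_inl ffK_inl_inr ffK_inr_inl ffK_inr_inr divV_apply)
open Summit.QuantumFields.BalabanUV.Beta.VertexReflectionContact (mmRead_neg mmRead_add)
open Summit.QuantumFields.BalabanUV.Beta.GAN24.ThirdJetKernel (mmRead_sub)

namespace Summit.QuantumFields.BalabanUV.Beta.WardLocusCubic

variable {d : ℕ}

/-! ## §1 The cubic jet of a packed resolvent; the sandwiched commutator under the relative rules -/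

section Sandwich

variable {N : ℕ}

/-- [folklore] **THE VALUE-FUNCTION CUBIC JET OF A PACKED RESOLVENT** `K` (blocking `N`) over a fine stencil family `S`, at the coarse jet bond
`(κ′, u′)`: `−mmRead N (K ∘ vertexOfK K N S κ′ u′ ∘ K)` — an2's `e3NAtOf` with the resolvent as a parameter. -/
def e3K (K : MKer (d + 1) (Fib d)) (N : ℕ) (S : Fin (d + 1) → (Fin (d + 1) → ℤ) → MKer (d + 1) (Fib d)) :
    Fin (d + 1) → (Fin (d + 1) → ℤ) → MKer (d + 1) (Fib d) :=
  fun κ' u' => -mmRead N (comp (comp K (vertexOfK K N S κ' u')) K)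

/-- [folklore] For the one-shot resolvent `KInv (Lc^j)` over the composite `ScNAt ρ (j−1)` this IS an2's `e3NAtOf ρ j` (`vertexOfK_KInv`). -/
theorem e3NAtOf_eq_e3K {Lc : ℕ} [NeZero Lc] (ρ : Fin (d + 1) → ℤ) (cE cVH cΛ : ℝ) (j : ℕ) :
    e3NAtOf d Lc ρ cE cVH cΛ j = e3K (KInv (N := Lc ^ j) (d := d)) (Lc ^ j) (ScNAt d Lc ρ cE cVH cΛ (j - 1)) := by
  funext κ' u' x z a b
  simp only [e3NAtOf, e3K, vertexOfK_KInv, Pi.neg_apply]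

/-- [folklore] `mmRead` commutes with finite sums. -/
theorem mmRead_finset_sum {ι : Type*} (s : Finset ι) (M : ℕ) (F : ι → MKer (d + 1) (Fib d)) :
    mmRead M (∑ i ∈ s, F i) = ∑ i ∈ s, mmRead M (F i) := by
  classical
  induction s using Finset.induction_on with
  | empty => funext x z a b; rcases a with α | μ <;> rcases b with β | ν <;> simp [mmRead]
  | insert i s hi ih =>
    rw [Finset.sum_insert hi, Finset.sum_insert hi, ← ih]
    funext x z a b
    rcases a with α | μ <;> rcases b with β | ν <;> simp [mmRead]

/-- [folklore] **THE SANDWICHED COMMUTATOR UNDER THE RELATIVE RULES**: `A ∘ conjV 𝕄 X ∘ A = X ∘ A − A ∘ X` for `RelInv A 𝕄 E` and a localised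
`X` commuting with `E` (`rule_left_rel`: `(A∘𝕄)∘(X∘A) = X∘A`; `rule_right_rel`: `(A∘X)∘(𝕄∘A) = A∘X`). -/
theorem comp_conjV_comp_rel {A M E : MKer (d + 1) (Fib d)} (hA : Spr A) (hM : Spr M) (hE : Spr E) (hR : RelInv A M E)
    {X : MKer (d + 1) (Fib d)} (hX : Loc X) (hEX : comp E X = comp X E) :
    comp (comp A (conjV M X)) A = comp X A - comp A X := by
  have hMX : Loc (comp M X) := hM.comp_loc hX
  have hXM : Loc (comp X M) := hX.comp_spr hM
  have t1 : comp (comp A (comp M X)) A = comp X A :=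
    calc comp (comp A (comp M X)) A = comp (comp (comp A M) X) A := by rw [comp_assoc_tame hA.tame hM.tame hX.tame]
      _ = comp (comp A M) (comp X A) := (comp_assoc_tame (spr_comp hA hM).tame hX.tame hA.tame).symm
      _ = comp X A := rule_left_rel hA hM hE hR hX hEX
  have t2 : comp (comp A (comp X M)) A = comp A X :=
    calc comp (comp A (comp X M)) A = comp (comp (comp A X) M) A := by rw [comp_assoc_tame hA.tame hX.tame hM.tame]
      _ = comp (comp A X) (comp M A) := (comp_assoc_tame (hA.comp_loc hX).tame hM.tame hA.tame).symm
      _ = comp A X := rule_right_rel hA hM hE hR hX hEX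
  unfold conjV
  rw [comp_sub_right_tame hA.tame hMX.tame hXM.tame,
    comp_sub_left_tame (hA.comp_loc hMX).tame (hA.comp_loc hXM).tame hA.tame, t1, t2]

/-- [folklore] `A ∘ (Σ_i K_i) = Σ_i A ∘ K_i` for tame `A` and localised summands. -/
theorem comp_finset_sum_right {ι : Type*} (s : Finset ι) {A : MKer (d + 1) (Fib d)} (hA : Tame A) {K : ι → MKer (d + 1) (Fib d)}
    (hK : ∀ i, Loc (K i)) : comp A (∑ i ∈ s, K i) = ∑ i ∈ s, comp A (K i) := by
  classical
  induction s using Finset.induction_on with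
  | empty =>
    simp only [Finset.sum_empty]
    funext x z a b
    simp [ExpKernelCalculus.comp]
  | insert i s hi ih =>
    rw [Finset.sum_insert hi, Finset.sum_insert hi, ← ih]
    exact comp_add_right_tame hA (hK i).tame (KernelWardRelative.loc_finset_sum s (fun j => hK j)).tame

/-- [folklore] `(Σ_i K_i) ∘ M = Σ_i K_i ∘ M` for localised summands and tame `M`. -/
theorem comp_finset_sum_left {ι : Type*} (s : Finset ι) {K : ι → MKer (d + 1) (Fib d)} (hK : ∀ i, Loc (K i))
    {M : MKer (d + 1) (Fib d)} (hM : Tame M) : comp (∑ i ∈ s, K i) M = ∑ i ∈ s, comp (K i) M := by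
  classical
  induction s using Finset.induction_on with
  | empty =>
    simp only [Finset.sum_empty]
    funext x z a b
    simp [ExpKernelCalculus.comp]
  | insert i s hi ih =>
    rw [Finset.sum_insert hi, Finset.sum_insert hi, ← ih]
    exact comp_add_left_tame (hK i).tame (KernelWardRelative.loc_finset_sum s (fun j => hK j)).tame hM

/-- [folklore] **THE DIVERGENCE PASSES THROUGH THE SANDWICH**: for `Spr K` and localised vertices,
`divV (κ u ↦ −mmRead N (K ∘ V κ u ∘ K)) y = −mmRead N (K ∘ divV V y ∘ K)`. -/
theorem divV_sandwich {K : MKer (d + 1) (Fib d)} (hK : Spr K) {V : Fin (d + 1) → (Fin (d + 1) → ℤ) → MKer (d + 1) (Fib d)}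
    (hV : ∀ μ y, Loc (V μ y)) (N : ℕ) (y : Fin (d + 1) → ℤ) :
    divV (fun μ u => -mmRead N (comp (comp K (V μ u)) K)) y = -mmRead N (comp (comp K (divV V y)) K) := by
  have hD : ∀ μ : Fin (d + 1), Loc (V μ (y - B6BondElimination.unitVec μ) - V μ y) := fun μ => (hV μ _).sub (hV μ y)
  have hdiff : ∀ μ : Fin (d + 1),
      comp (comp K (V μ (y - B6BondElimination.unitVec μ) - V μ y)) K =
        comp (comp K (V μ (y - B6BondElimination.unitVec μ))) K - comp (comp K (V μ y)) K := by
    intro μ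
    rw [comp_sub_right_tame hK.tame (hV μ _).tame (hV μ y).tame,
      comp_sub_left_tame (hK.comp_loc (hV μ _)).tame (hK.comp_loc (hV μ y)).tame hK.tame]
  have hsum : comp (comp K (divV V y)) K = ∑ μ, comp (comp K (V μ (y - B6BondElimination.unitVec μ) - V μ y)) K := by
    simp only [KernelWard.divV]
    rw [comp_finset_sum_right Finset.univ hK.tame hD, comp_finset_sum_left Finset.univ (fun μ => hK.comp_loc (hD μ)) hK.tame]
  rw [hsum, mmRead_finset_sum]
  funext x z a b
  rw [divV_apply]
  simp only [Pi.neg_apply, Finset.sum_apply, hdiff, mmRead_sub, Pi.sub_apply, ← Finset.sum_neg_distrib]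
  exact Finset.sum_congr rfl fun μ _ => by ring

end Sandwich

/-! ## §2 The multiplier-block read of a diagonal contact; the block-rotation generator read on the step lattice -/

section Read

variable {N : ℕ}

/-- [folklore] `K ∘ diagK g − diagK g ∘ K = conjV K (diagK g)` (definitional). -/
theorem comp_diagK_sub_eq_conjV (K : MKer (d + 1) (Fib d)) (g : (Fin (d + 1) → ℤ) → Fib d → ℝ) :
    comp K (diagK g) - comp (diagK g) K = conjV K (diagK g) := rfl

/-- [folklore] THE MULTIPLIER-LEG SYMBOL READ ON THE STEP LATTICE: `mmSym N g x′ (inl α) := g (N•x′) (inr α)` (field legs of the step lattice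
are the multiplier legs of the coarse points), `0` on the step lattice's multiplier legs. -/
def mmSym (N : ℕ) (g : (Fin (d + 1) → ℤ) → Fib d → ℝ) : (Fin (d + 1) → ℤ) → Fib d → ℝ := fun x' a =>
  match a with
  | Sum.inl α => g ((N : ℤ) • x') (Sum.inr α)
  | Sum.inr _ => 0

/-- [folklore] **THE mm-READ OF A DIAGONAL CONTACT IS THE DIAGONAL CONTACT OF THE mm-READ**:
`mmRead N (conjV K (diagK g)) = conjV (mmRead N K) (diagK (mmSym N g))`. -/
theorem mmRead_conjV_diagK (N : ℕ) (K : MKer (d + 1) (Fib d)) (g : (Fin (d + 1) → ℤ) → Fib d → ℝ) :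
    mmRead N (conjV K (diagK g)) = conjV (mmRead N K) (diagK (mmSym N g)) := by
  funext x z a b
  rw [conjV_diagK_apply]
  rcases a with α | μ <;> rcases b with β | ν
  · rw [mmRead_inl_inl, mmRead_inl_inl, conjV_diagK_apply]; rfl
  · rw [mmRead_inr_right, mmRead_inr_right, zero_mul]
  · rw [mmRead_inr_left, mmRead_inr_left, zero_mul]
  · rw [mmRead_inr_left, mmRead_inr_left, zero_mul]

/-- [folklore] A diagonal contact of an `mm`-read (a kernel living on the field block) only sees the symbol's FIELD legs. -/
theorem conjV_mmRead_diagK_congr (N : ℕ) (K : MKer (d + 1) (Fib d)) {g g' : (Fin (d + 1) → ℤ) → Fib d → ℝ}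
    (h : ∀ x α, g x (Sum.inl α) = g' x (Sum.inl α)) :
    conjV (mmRead N K) (diagK g) = conjV (mmRead N K) (diagK g') := by
  funext x z a b
  rw [conjV_diagK_apply, conjV_diagK_apply]
  rcases a with α | μ <;> rcases b with β | ν
  · rw [h, h]
  · rw [mmRead_inr_right, zero_mul, zero_mul]
  · rw [mmRead_inr_left, zero_mul, zero_mul]
  · rw [mmRead_inr_left, zero_mul, zero_mul]

/-- [folklore] The diagonal contact is homogeneous in the kernel: `conjV (c • M) (diagK g) = c • conjV M (diagK g)`. -/
theorem conjV_smul_diagK (c : ℝ) (M : MKer (d + 1) (Fib d)) (g : (Fin (d + 1) → ℤ) → Fib d → ℝ) :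
    conjV (c • M) (diagK g) = c • conjV M (diagK g) := by
  funext x z a b
  simp only [conjV_diagK_apply, Pi.smul_apply, smul_eq_mul]
  ring

/-- [folklore] Coarse images with in-block offsets: `N•x′ + r = N•y + v` with `r, v ∈ box N` forces `x′ = y` (and `v = r`). -/
theorem zsmul_add_toSite_eq_iff {r v : Fin (d + 1) → ℕ} (hr : r ∈ box (d + 1) N) (hv : v ∈ box (d + 1) N)
    (x' y : Fin (d + 1) → ℤ) : (N : ℤ) • x' + toSite r = (N : ℤ) • y + toSite v ↔ x' = y ∧ v = r := by
  constructor
  · intro h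
    have hb : x' = y := by
      have h1 : blk N ((N : ℤ) • x' + toSite r) = x' := blk_block x' hr
      have h2 : blk N ((N : ℤ) • y + toSite v) = y := blk_block y hv
      rw [h] at h1
      exact h1.symm.trans h2
    refine ⟨hb, ?_⟩
    rw [hb] at h
    exact (AxialProjector.toSite_injective (add_left_cancel h)).symm
  · rintro ⟨rfl, rfl⟩; rfl

/-- [folklore] **THE BLOCK-ROTATION GENERATOR READ ON THE STEP LATTICE IS THE SITE INDICATOR**: for an in-block root `ρ = toSite r`,
`mmSym N (ξ • Σ_{v ∈ box} legInd ρ (N•y + v)) x′ (inl α) = ξ·[x′ = y]` — the multiplier legs of the block `B(y)`'s rotation generator are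
the legs of the ONE step-lattice site `y`. -/
theorem mmSym_blockGen_inl {r : Fin (d + 1) → ℕ} (hr : r ∈ box (d + 1) N) (ξ : ℝ) (y x' : Fin (d + 1) → ℤ) (α : Fin (d + 1)) :
    mmSym N (ξ • ∑ v ∈ box (d + 1) N, legInd (toSite r) ((N : ℤ) • y + toSite v)) x' (Sum.inl α) =
      ξ * (if x' = y then 1 else 0) := by
  classical
  simp only [mmSym, Pi.smul_apply, Finset.sum_apply, smul_eq_mul, legInd_inr]
  congr 1
  by_cases hxy : x' = y
  · subst hxy
    rw [if_pos rfl]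
    rw [Finset.sum_eq_single r (fun v hv hvr => ?_) (fun h => absurd hr h)]
    · simp
    · rw [if_neg]
      intro h
      exact hvr ((zsmul_add_toSite_eq_iff hr hv x' x').1 h).2
  · rw [if_neg hxy]
    refine Finset.sum_eq_zero fun v hv => ?_
    rw [if_neg]
    intro h
    exact hxy ((zsmul_add_toSite_eq_iff hr hv x' y).1 h).1

end Read

/-! ## §3 THE CUBIC WARD LAW FROM THE COMPOSITE BLOCK WARD LAW -/

section Main

variable {N : ℕ}

/-- [folklore] **THE WARD LAW OF THE VALUE-FUNCTION CUBIC JET, REPAIR-AGNOSTIC.**  Let `K` be a decaying packed resolvent (blocking `N ≥ 1`)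
with `RelInv K 𝕄 E` (`𝕄`, `E` spread), `S` a local stencil family, `ρ = toSite r` an in-block root, and let the block-rotation generator
`X y := diagK (ξ • Σ_{v ∈ box} legInd ρ (N•y + v))` be localised and commute with `E`.  IF (hH) the ℋ-columns of `K` obey the Ward law with
constant `cH` and (hSd) the stencil family obeys the BLOCK Ward law `cH • Σ_v divV S (N•y + v) = conjV 𝕄 (X y)` (the level-below sockets of
an1's hW root), THEN the cubic jet `e3K K N S` obeys, at every step-lattice site `y` and for any root `ρ′` used to write the step generator,
`divV (e3K K N S) y = ξ • conjV (mmRead N K) (diagK (legInd ρ′ y))` — the diagonal contact of the value Hessian `mmRead N K` with the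
rotation generator of the ONE site `y`. -/
theorem divV_e3K_eq_conjV {K M E : MKer (d + 1) (Fib d)} (hKd : ∃ δ C : ℝ, 0 < δ ∧ 0 ≤ C ∧ Decays K C δ) (hM : Spr M) (hE : Spr E)
    (hR : RelInv K M E) (hN : 1 ≤ N) {S : Fin (d + 1) → (Fin (d + 1) → ℤ) → MKer (d + 1) (Fib d)} {Cs δs : ℝ}
    (hS : LocStencil S Cs δs) (hδs : 0 < δs) {r : Fin (d + 1) → ℕ} (hr : r ∈ box (d + 1) N) (cH ξ : ℝ)
    (hH : ∀ (y : Fin (d + 1) → ℤ) (κ' : Fin (d + 1)) (u : Fin (d + 1) → ℤ),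
      ∑ μ, (colH K N μ (y - B6BondElimination.unitVec μ) κ' u - colH K N μ y κ' u) = cH * gaugeWt N y κ' u)
    (hX : ∀ y : Fin (d + 1) → ℤ, Loc (diagK (ξ • ∑ v ∈ box (d + 1) N, legInd (toSite r) ((N : ℤ) • y + toSite v))))
    (hEX : ∀ y : Fin (d + 1) → ℤ, comp E (diagK (ξ • ∑ v ∈ box (d + 1) N, legInd (toSite r) ((N : ℤ) • y + toSite v))) =
      comp (diagK (ξ • ∑ v ∈ box (d + 1) N, legInd (toSite r) ((N : ℤ) • y + toSite v))) E)
    (hSd : ∀ y : Fin (d + 1) → ℤ, cH • ∑ v ∈ box (d + 1) N, divV S ((N : ℤ) • y + toSite v) =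
      conjV M (diagK (ξ • ∑ v ∈ box (d + 1) N, legInd (toSite r) ((N : ℤ) • y + toSite v))))
    (ρ' y : Fin (d + 1) → ℤ) :
    divV (e3K K N S) y = ξ • conjV (mmRead N K) (diagK (legInd ρ' y)) := by
  obtain ⟨δK, CK, hδK, hCK, hK⟩ := hKd
  have hKspr : Spr K := ⟨CK, δK, hδK, hK⟩
  obtain ⟨Cv, δv, hδv, hVF⟩ := vertexFamily_vertexOfK' (N := N) ⟨δK, CK, hδK, hCK, hK⟩ hS hδs
  have hV : ∀ μ y, Loc (vertexOfK K N S μ y) := fun μ y => ⟨_, _, Cv, δv, hδv, hVF μ y⟩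
  unfold e3K
  rw [divV_sandwich hKspr hV N y, divV_vertexOfK_eq_conjV (N := N) ⟨δK, CK, hδK, hCK, hK⟩ hN hS hδs cH hH hSd y,
    comp_conjV_comp_rel hKspr hM hE hR (hX y) (hEX y), ← neg_sub, comp_diagK_sub_eq_conjV, mmRead_neg, neg_neg, mmRead_conjV_diagK,
    conjV_mmRead_diagK_congr N K (g' := ξ • legInd ρ' y) (fun x α => by
      rw [mmSym_blockGen_inl hr]; simp only [Pi.smul_apply, smul_eq_mul, legInd_inl]),
    WardLocusS0N.conjV_diagK_smul]

/-- [folklore] **FOR THE hW SOCKET**: the field–field part of the candidate step Hessian is the weighted value Hessian,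
`ffK (bhKStepAt d ρ Lc (j+1)) = wVH (j+1) • mmRead (Lc^(j+1)) (KInv (Lc^(j+1)))`, so for `K = KInv (Lc^(j+1))` the conclusion of
`divV_e3K_eq_conjV` reads `divV (e3NAtOf ρ … (j+1)) y = (ξ / wVH (j+1)) • conjV (ffK (bhKStepAt …)) (diagK (legInd ρ′ y))` — exactly the
hypothesis `hW` of `WardLocusStep.hSd_SstepNAt_of_e3Ward` with `c3 = ξ / wVH (j+1)` (IF the raw one-shot resolvent meets the sockets, which is
NOT claimed — cf. the hR (L3) toy verdict). -/
theorem ffK_bhKStepAt_succ {Lc : ℕ} [NeZero Lc] (ρ : Fin (d + 1) → ℤ) (j : ℕ) :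
    ffK (bhKStepAt d ρ Lc (j + 1)) = wVH d Lc (j + 1) • mmRead (Lc ^ (j + 1)) (KInv (N := Lc ^ (j + 1)) (d := d)) := by
  funext x z a b
  simp only [Pi.smul_apply, smul_eq_mul]
  rcases a with α | μ <;> rcases b with β | ν
  · rw [ffK_inl_inl, bhKStepAt_succ_inl_inl]; rfl
  · rw [ffK_inl_inr, mmRead_inr_right, mul_zero]
  · rw [ffK_inr_inl, mmRead_inr_left, mul_zero]
  · rw [ffK_inr_inr, mmRead_inr_left, mul_zero]

/-- [folklore] The socket of `WardLocusStep.hSd_SstepNAt_of_e3Ward` FROM the composite block Ward law, for the RAW one-shot resolvent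
(all of whose laws are hypotheses here): `divV (e3NAtOf ρ cE cVH cΛ (j+1)) y = (ξ / wVH (j+1)) • conjV (ffK (bhKStepAt d ρ Lc (j+1))) (diagK (legInd ρ y))`. -/
theorem divV_e3NAtOf_eq_conjV {Lc : ℕ} [NeZero Lc] (hLc : 1 ≤ Lc) (r : Fin (d + 1) → ℕ) (cE cVH cΛ : ℝ) (j : ℕ)
    {M E : MKer (d + 1) (Fib d)} (hM : Spr M) (hE : Spr E) (hR : RelInv (KInv (N := Lc ^ (j + 1)) (d := d)) M E)
    {Cs δs : ℝ} (hS : LocStencil (ScNAt d Lc (toSite r) cE cVH cΛ j) Cs δs) (hδs : 0 < δs)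
    {r' : Fin (d + 1) → ℕ} (hr' : r' ∈ box (d + 1) (Lc ^ (j + 1))) (cH ξ : ℝ)
    (hH : ∀ (y : Fin (d + 1) → ℤ) (κ' : Fin (d + 1)) (u : Fin (d + 1) → ℤ),
      ∑ μ, (colH (KInv (N := Lc ^ (j + 1)) (d := d)) (Lc ^ (j + 1)) μ (y - B6BondElimination.unitVec μ) κ' u -
        colH (KInv (N := Lc ^ (j + 1)) (d := d)) (Lc ^ (j + 1)) μ y κ' u) = cH * gaugeWt (Lc ^ (j + 1)) y κ' u)
    (hX : ∀ y : Fin (d + 1) → ℤ, Loc (diagK (ξ • ∑ v ∈ box (d + 1) (Lc ^ (j + 1)), legInd (toSite r') (((Lc ^ (j + 1) : ℕ) : ℤ) • y + toSite v))))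
    (hEX : ∀ y : Fin (d + 1) → ℤ, comp E (diagK (ξ • ∑ v ∈ box (d + 1) (Lc ^ (j + 1)), legInd (toSite r') (((Lc ^ (j + 1) : ℕ) : ℤ) • y + toSite v))) =
      comp (diagK (ξ • ∑ v ∈ box (d + 1) (Lc ^ (j + 1)), legInd (toSite r') (((Lc ^ (j + 1) : ℕ) : ℤ) • y + toSite v))) E)
    (hSd : ∀ y : Fin (d + 1) → ℤ, cH • ∑ v ∈ box (d + 1) (Lc ^ (j + 1)), divV (ScNAt d Lc (toSite r) cE cVH cΛ j) (((Lc ^ (j + 1) : ℕ) : ℤ) • y + toSite v) =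
      conjV M (diagK (ξ • ∑ v ∈ box (d + 1) (Lc ^ (j + 1)), legInd (toSite r') (((Lc ^ (j + 1) : ℕ) : ℤ) • y + toSite v))))
    (y : Fin (d + 1) → ℤ) :
    divV (e3NAtOf d Lc (toSite r) cE cVH cΛ (j + 1)) y =
      (ξ / wVH d Lc (j + 1)) • conjV (ffK (bhKStepAt d (toSite r) Lc (j + 1))) (diagK (legInd (toSite r) y)) := by
  have hN : 1 ≤ Lc ^ (j + 1) := Nat.one_le_pow _ _ (by omega)
  have hw : wVH d Lc (j + 1) ≠ 0 := by
    unfold BalabanStepJetsSucc.wVH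
    exact pow_ne_zero _ (pow_ne_zero _ (by exact_mod_cast (show Lc ≠ 0 by omega)))
  rw [ffK_bhKStepAt_succ, conjV_smul_diagK, smul_smul, div_mul_cancel₀ ξ hw, e3NAtOf_eq_e3K]
  simp only [Nat.add_sub_cancel]
  exact divV_e3K_eq_conjV (OneStepResolventKernel.decays_KInv (N := Lc ^ (j + 1)) (d := d)) hM hE hR hN hS hδs hr' cH ξ hH hX hEX hSd
    (toSite r) y

end Main

end Summit.QuantumFields.BalabanUV.Beta.WardLocusCubic

end
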